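import Summits.QuantumFields.YangMills.Theorems.BalabanUVNodesN15KingModelB9Thm31AllAtTrivialU
import Summits.QuantumFields.YangMills.Theorems.BalabanUVNodesN15KingModelFullPropagatorGradProfileDecay

/-!
# BalabanUVNodes ∕ N15 — THE KING-MODEL RUNG, CURVED EDITION (PART Ξ-a): [B9] (3.46) AT `U ≡ 1`, PRINTED (LOCALISED) SHAPE — THE `L²` BOUNDS
# `‖h·A₀⁻¹λ‖, ‖h·∇A₀⁻¹λ‖, ‖h·A₀⁻¹∇*λ‖ ≤ C·|h|_∞·e^{−δ|b − b′|}·‖λ‖` FOR CUT-OFFS `h` SUPPORTED IN A UNIT BLOCK `b` AND SOURCES `λ` SUPPORTED IN A UNIT BLOCK `b′`,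
# for King's full `A = 0` propagator, UNIFORMLY in `K`, the volume and the mass (Schur's test on the level profiles)
# (Track A, DAG node N15 = NE2; FAN-OUT v1.1 §N15 s3 «KING-MODEL RUNG … + the one-line statement of what the curved case adds»)

HONEST FRAMING.  Count-neutral operator bookkeeping (cell `pub-ymgap`, seat `pub-ymgap-dag-n15-e` g10; `--supports stmt-QuantumFields-20544 --as helper` = K3⁷
`SpineGivenEndpointR13SepCoPH`, WORDS-143).  TEMPLATE LITERATURE, `A = 0`: C. King's scalar U(1)-Higgs MODEL on finite tori ([King1986] (2.13) p. 653,
Thm 3.3 (3.7) p. 656, Prop. 3.7 (3.63) p. 663), NOT Bałaban's covariant objects.  [Balaban1985BackgroundPropagators] Thm 3.1 p. 398 prints (3.46): «the `L²`-norm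
inequalities `‖hG′λ‖, ‖h∇_UG′λ‖, ‖hG′∇*_Uλ‖, ‖h∇_UG′∇*_Uλ‖, ‖h∇_U∇_UG′λ‖, ‖hG′∇*_U∇*_Uλ‖ ≤ B₀[(L^jη)², L^jη, L^jη, 1, 1, 1]|h|e^{−δ₀d(y,y′)}‖λ‖` for
`supp h ⊂ Δ(y)`, `supp λ ⊂ Δ(y′)`» — LOCALISED `L²` bounds with exponential decay between the cut-off's and the source's blocks.  Part X (`fullPropOps_l2_unif`)
decided the GLOBAL versions at `U ≡ 1`; THIS FILE decides the printed localised shape of the first THREE entries for King's full `A = 0` propagator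
`A₀⁻¹ = G_K(T_ε, 0)` at `U ≡ 1` (unit-scale sites: prefactors `1`), by SCHUR'S TEST on the level profiles of parts R-d ∕ R-e (the sequel Ξ-b: the fourth
entry `h∇G∇*λ`).  Decided in the MODEL; NOT the printed proposition (covariant `G(U)`, `Reg335`, multiscale sites); the entries `h∇∇Gλ`, `hG∇*∇*λ` (second
differences on ONE side) are NOT treated (no kernel profile for `∇∇G` in the tree); NE2⁺ is NOT PRINTED and not proved; NOT a node discharge; nothing
continuum ∕ ℝ⁴ ∕ OS ∕ mass-gap ∕ Clay.  0 `sorry`, 0 `def`, standard axioms.  (The lit desk's census G-B9-03a records that (3.44)–(3.46) for `G′` at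
`U = 1` have no printed statement in [B6]; parts V ∕ Ψ ∕ Ξ are kernel proofs of these displays in the simplest instance — periodic, single domain, `A = 0`.)
* §1 `schur_finsum_sq_le` (Schur's test, finite signed form — the series form is the tree's `B5Hk165L2Zd.schur_tsum`: `Σ_x(Σ_z K(x,z)f(z))² ≤ R·C·Σf²`), `profile_fineSum_le`
  (`Σ_z N^{−(d+1)}Σ_{i<K}Λ^i e^{−δr L^i∕N} ≤ 2(4(d+1)∕δ)^{d+1}` for `Λ ≤ L^d`, `0 < δ ≤ 1`), ★ `l2_local_of_kernel_bound` (the localised Schur step);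
* §2 ★★ `fullPropOp_l2_local` (entry `hGλ`, part R-d `fullProp_profile_decay_unif`, `Λ = L^{d+1}∕L²`), ★★ `fullPropDOp_l2_local` (entry `h∇Gλ`, part R-e
  `fullPropD_profile_decay_unif`, `Λ = L^d`), ★★ `fullPropAdjOp_l2_local` (entry `hG∇*λ`, the same profile at the transposed pair, Q4a `inv_mulVec_adjDeriv_eq_sum`).
WHAT THE CURVED CASE ADDS (one line): (3.46) itself for `G′(U)` over `Reg335` with the multiscale prefactors — printed, by the random-walk expansion.
HONEST SCOPE.  (i) `A = 0`, periodic b.c., odd `L ≥ 3`, cubes `2L^e`, `K ≥ 1`, `0 < m² ≤ m₀²`; (ii) King's spelling, plain `ℓ²` sums over the fine torus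
(a common weight cancels), forward η-differences; (iii) cut-off and source supported in ONE unit block each (`Δ(y) = B^k(y)` at the unit scale); (iv) entries
1–3 of six; (v) not Bałaban's `G(U)`; not a discharge.
Locators: [Balaban1985BackgroundPropagators] Thm 3.1 (3.46) p. 398; [King1986] (2.13) p. 653, Thm 3.3 (3.7) p. 656, Prop. 3.7 (3.63) p. 663;
[Balaban1983RegularityDecay] Theorem (1.10) p. 573, §5 (5.7)–(5.8) p. 594.
-/

noncomputable section

namespace Summit.QuantumFields.YangMills.BalabanUVNodes.N15KingModelRung.Curved

open Real Finset Matrix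
open Literature.MathematicalPhysics.QuantumFieldTheory.Balaban1983to89.B4Sect5Proof (latticeConst)
open Literature.MathematicalPhysics.QuantumFieldTheory.Balaban1983to89.B5Prop11Plancherel (Tor fine unitVec)
open Literature.MathematicalPhysics.QuantumFieldTheory.King1986 (aK aK_pos)
open Literature.MathematicalPhysics.QuantumFieldTheory.King1986.Torus (fineOp constrainedProp blockOf tdistT tdistT_nonneg tdistT_symm
  tdistT_self tdistT_sumBound)

variable {d : ℕ} (L : ℕ) [NeZero L]

/-! ## §1 Schur's test and the fine-torus sums of the level profiles -/

omit [NeZero L] in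
/-- **SCHUR'S TEST, FINITE SIGNED-KERNEL FORM** (squared): if every row sum of `|K|` is `≤ R` (`R ≥ 0`) and every column sum is `≤ C`, then
`Σ_x (Σ_z K(x, z)f(z))² ≤ R·C·Σ_z f(z)²` — Cauchy–Schwarz with the weight `|K(x, ·)|`, then the column sums.  (The tree's
`B5Hk165L2Zd.schur_tsum` is the SERIES form on `ℤ^d` for non-negative kernels against `|f|`; this is its finite-torus twin for signed kernels,
stated with `Finset.sum`, which is what the localised bounds below consume.) [folklore] -/
theorem schur_finsum_sq_le {ι κ : Type*} [Fintype ι] [Fintype κ] (K : ι → κ → ℝ) (f : κ → ℝ) {R C : ℝ} (hR0 : 0 ≤ R)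
    (hR : ∀ x, ∑ z, |K x z| ≤ R) (hC : ∀ z, ∑ x, |K x z| ≤ C) :
    ∑ x, (∑ z, K x z * f z) ^ 2 ≤ R * C * ∑ z, f z ^ 2 := by
  have hx : ∀ x, (∑ z, K x z * f z) ^ 2 ≤ R * ∑ z, |K x z| * f z ^ 2 := by
    intro x
    have habs := abs_le.mp (Finset.abs_sum_le_sum_abs (fun z => K x z * f z) Finset.univ)
    have h1 : (∑ z, K x z * f z) ^ 2 ≤ (∑ z, |K x z * f z|) ^ 2 := sq_le_sq' habs.1 habs.2
    have h2 : (∑ z, |K x z * f z|) ^ 2 ≤ (∑ z, |K x z|) * ∑ z, |K x z| * f z ^ 2 :=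
      Finset.sum_sq_le_sum_mul_sum_of_sq_le_mul Finset.univ (fun z _ => abs_nonneg _)
        (fun z _ => mul_nonneg (abs_nonneg _) (sq_nonneg _))
        (fun z _ => by rw [abs_mul, mul_pow, sq_abs (f z)]; exact le_of_eq (by ring))
    exact h1.trans (h2.trans (mul_le_mul_of_nonneg_right (hR x) (Finset.sum_nonneg fun z _ => by positivity)))
  calc ∑ x, (∑ z, K x z * f z) ^ 2 ≤ ∑ x, R * ∑ z, |K x z| * f z ^ 2 := Finset.sum_le_sum fun x _ => hx x
    _ = R * ∑ z, (∑ x, |K x z|) * f z ^ 2 := by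
        rw [← Finset.mul_sum, Finset.sum_comm]
        congr 1
        exact Finset.sum_congr rfl fun z _ => by rw [Finset.sum_mul]
    _ ≤ R * ∑ z, C * f z ^ 2 :=
        mul_le_mul_of_nonneg_left (Finset.sum_le_sum fun z _ => mul_le_mul_of_nonneg_right (hC z) (sq_nonneg _)) hR0
    _ = R * C * ∑ z, f z ^ 2 := by rw [← Finset.mul_sum, mul_assoc]

omit [NeZero L] in
/-- **The fine-torus sum of a level profile is uniformly bounded**: for `L ≥ 2`, `N = L^K`, `0 < δ ≤ 1`, `0 ≤ Λ ≤ L^d` and every fine point `x`,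
`Σ_z N^{−(d+1)}·Σ_{i<K}Λ^i e^{−δ·|x − z|·L^i∕N} ≤ 2·(4(d+1)∕δ)^{d+1}` — level `i` lives on the scale `N∕L^i`, its lattice sum is `≤ (4(d+1)N∕(δL^i))^{d+1}`
(part V-b `latticeConst_le_of_le`), and `N^{−(d+1)}Λ^i(N∕L^i)^{d+1} ≤ (L⁻¹)^i` sums to `≤ 2` (part S-b `sum_inv_pow_le_two`).
[cite: Balaban1983RegularityDecay, §5 (5.7)–(5.8) p.594 (the lattice sums); King1986, (2.17) p.653, Prop. 3.7 (3.63) p.663] -/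
theorem profile_fineSum_le (hL : 2 ≤ L) {K : ℕ} (N : ℕ) [NeZero N] (hN : N = L ^ K) (M : Fin (d + 1) → ℕ) [∀ μ, NeZero (M μ)]
    {δ Λ : ℝ} (hδ0 : 0 < δ) (hδ1 : δ ≤ 1) (hΛ0 : 0 ≤ Λ) (hΛ : Λ ≤ (L : ℝ) ^ d) (x : Tor (fine N M)) :
    ∑ z, ((N : ℝ) ^ (d + 1))⁻¹ * ∑ i ∈ Finset.range K, Λ ^ i * Real.exp (-(δ * (tdistT (fine N M) x z * (L : ℝ) ^ i / (N : ℝ))))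
      ≤ 2 * (4 * ((d : ℝ) + 1) / δ) ^ (d + 1) := by
  have hLr : (2 : ℝ) ≤ L := by exact_mod_cast hL
  have hL0 : (0 : ℝ) < L := by linarith
  have hN1 : (1 : ℝ) ≤ (N : ℝ) := by rw [hN]; exact_mod_cast Nat.one_le_pow K L (by omega)
  have hN0 : 0 < (N : ℝ) := by linarith
  have hNK : (N : ℝ) = (L : ℝ) ^ K := by rw [hN, Nat.cast_pow]
  set A : ℝ := (4 * ((d : ℝ) + 1) / δ) ^ (d + 1) with hAdef
  have hA0 : 0 ≤ A := by positivity
  -- swap the sums; one level at a time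
  rw [Finset.sum_congr rfl fun z _ => (Finset.mul_sum _ _ _), Finset.sum_comm]
  have hlevel : ∀ i ∈ Finset.range K,
      ∑ z, ((N : ℝ) ^ (d + 1))⁻¹ * (Λ ^ i * Real.exp (-(δ * (tdistT (fine N M) x z * (L : ℝ) ^ i / (N : ℝ)))))
        ≤ A * ((L : ℝ)⁻¹) ^ i := by
    intro i hi
    have hiK : i < K := Finset.mem_range.mp hi
    have hq0 : (0 : ℝ) < (L : ℝ) ^ i := by positivity
    have hqN : (L : ℝ) ^ i ≤ (N : ℝ) := by rw [hNK]; exact pow_le_pow_right₀ (by linarith) hiK.le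
    set κ : ℝ := δ * (L : ℝ) ^ i / (N : ℝ) with hκdef
    have hκ0 : 0 < κ := by positivity
    have hκ1 : κ ≤ ((d + 1 : ℕ) : ℝ) := by
      have h1 : κ ≤ 1 := by
        rw [hκdef, div_le_one hN0]
        calc δ * (L : ℝ) ^ i ≤ 1 * (L : ℝ) ^ i := mul_le_mul_of_nonneg_right hδ1 hq0.le
          _ ≤ (N : ℝ) := by rw [one_mul]; exact hqN
      have h2 : (1 : ℝ) ≤ ((d + 1 : ℕ) : ℝ) := by exact_mod_cast Nat.le_add_left 1 d
      linarith
    have hsum : ∑ z, Real.exp (-(κ * tdistT (fine N M) x z)) ≤ (4 * ((d + 1 : ℕ) : ℝ) / κ) ^ (d + 1) :=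
      (tdistT_sumBound (fine N M) κ hκ0 x).trans (latticeConst_le_of_le (d + 1) (by omega) hκ0 hκ1)
    have hrw : ∀ z, ((N : ℝ) ^ (d + 1))⁻¹ * (Λ ^ i * Real.exp (-(δ * (tdistT (fine N M) x z * (L : ℝ) ^ i / (N : ℝ)))))
        = ((N : ℝ) ^ (d + 1))⁻¹ * Λ ^ i * Real.exp (-(κ * tdistT (fine N M) x z)) := fun z => by
      rw [hκdef, mul_assoc]; congr 2; ring
    rw [Finset.sum_congr rfl fun z _ => hrw z, ← Finset.mul_sum]
    have hκinv : (4 * ((d + 1 : ℕ) : ℝ) / κ) ^ (d + 1) = A * ((N : ℝ) / (L : ℝ) ^ i) ^ (d + 1) := by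
      rw [hAdef, ← mul_pow]; congr 1; rw [hκdef]; push_cast; field_simp
    have hΛi : Λ ^ i ≤ ((L : ℝ) ^ d) ^ i := pow_le_pow_left₀ hΛ0 hΛ i
    calc ((N : ℝ) ^ (d + 1))⁻¹ * Λ ^ i * ∑ z, Real.exp (-(κ * tdistT (fine N M) x z))
        ≤ ((N : ℝ) ^ (d + 1))⁻¹ * ((L : ℝ) ^ d) ^ i * (A * ((N : ℝ) / (L : ℝ) ^ i) ^ (d + 1)) := by
          rw [← hκinv]
          exact mul_le_mul (mul_le_mul_of_nonneg_left hΛi (by positivity)) hsum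
            (Finset.sum_nonneg fun z _ => (Real.exp_pos _).le) (by positivity)
      _ = A * ((L : ℝ)⁻¹) ^ i := by
          rw [div_pow, inv_pow, ← pow_mul, ← pow_mul]
          field_simp
          ring
  calc ∑ i ∈ Finset.range K, ∑ z, ((N : ℝ) ^ (d + 1))⁻¹ * (Λ ^ i * Real.exp (-(δ * (tdistT (fine N M) x z * (L : ℝ) ^ i / (N : ℝ)))))
      ≤ ∑ i ∈ Finset.range K, A * ((L : ℝ)⁻¹) ^ i := Finset.sum_le_sum hlevel
    _ = A * ∑ i ∈ Finset.range K, ((L : ℝ)⁻¹) ^ i := by rw [Finset.mul_sum]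
    _ ≤ A * 2 := mul_le_mul_of_nonneg_left (sum_inv_pow_le_two hLr K) hA0
    _ = 2 * A := mul_comm _ _

omit [NeZero L] in
/-- ★ **THE LOCALISED SCHUR STEP**: let a kernel `k` on the fine torus satisfy `|k(x, z)| ≤ C₀·P(x, z)·e^{−δ₀|B(x) − B(z)|}` with a nonnegative majorant
`P` whose weighted row and column sums are `≤ A` (`Σ_z N^{−(d+1)}P(x, z) ≤ A`, `Σ_x N^{−(d+1)}P(x, z) ≤ A`); then for every cut-off `h` with
`|h| ≤ H_h` supported in the unit block `b` and every source `λ` supported in the unit block `b′`: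
`Σ_x (h(x)·Σ_z N^{−(d+1)}k(x, z)λ(z))² ≤ (C₀·A·H_h·e^{−δ₀|b − b′|})²·Σ_zλ(z)²` — §1's Schur test for the kernel `h(x)·N^{−(d+1)}k(x, z)·1_{b′}(z)`.
[cite: Balaban1985BackgroundPropagators, Thm 3.1 (3.46) p.398 (shape)] -/
theorem l2_local_of_kernel_bound (N : ℕ) [NeZero N] (M : Fin (d + 1) → ℕ) [∀ μ, NeZero (M μ)]
    (k P : Tor (fine N M) → Tor (fine N M) → ℝ) {C₀ δ₀ A : ℝ} (hC₀ : 0 ≤ C₀) (hA : 0 ≤ A)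
    (hP0 : ∀ x z, 0 ≤ P x z)
    (hk : ∀ x z, |k x z| ≤ C₀ * P x z * Real.exp (-(δ₀ * tdistT M (blockOf N M x) (blockOf N M z))))
    (hProw : ∀ x, ∑ z, ((N : ℝ) ^ (d + 1))⁻¹ * P x z ≤ A) (hPcol : ∀ z, ∑ x, ((N : ℝ) ^ (d + 1))⁻¹ * P x z ≤ A)
    (lam h : Tor (fine N M) → ℝ) {Hh : ℝ} (b b' : Tor M) (hHh : 0 ≤ Hh) (hh : ∀ x, |h x| ≤ Hh)
    (hsh : ∀ x, h x ≠ 0 → blockOf N M x = b) (hsl : ∀ z, lam z ≠ 0 → blockOf N M z = b') :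
    ∑ x, (h x * ∑ z, ((N : ℝ) ^ (d + 1))⁻¹ * k x z * lam z) ^ 2
      ≤ (C₀ * A * Hh * Real.exp (-(δ₀ * tdistT M b b'))) ^ 2 * ∑ z, lam z ^ 2 := by
  classical
  set c : ℝ := ((N : ℝ) ^ (d + 1))⁻¹ with hcdef
  have hc0 : 0 ≤ c := by positivity
  set E : ℝ := Real.exp (-(δ₀ * tdistT M b b')) with hEdef
  -- the Schur kernel: cut-off on the left, the source's block indicator on the right
  set Kk : Tor (fine N M) → Tor (fine N M) → ℝ := fun x z => h x * (c * k x z) * (if blockOf N M z = b' then 1 else 0) with hKk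
  have hrepr : ∀ x, h x * ∑ z, c * k x z * lam z = ∑ z, Kk x z * lam z := by
    intro x
    rw [Finset.mul_sum]
    refine Finset.sum_congr rfl fun z _ => ?_
    by_cases hz : lam z = 0
    · rw [hz, mul_zero, mul_zero, mul_zero]
    · rw [hKk]; simp only [hsl z hz, if_true]; ring
  rw [Finset.sum_congr rfl fun x _ => by rw [hrepr x]]
  set R : ℝ := C₀ * A * Hh * E with hRdef
  have hR0 : 0 ≤ R := by positivity
  -- termwise bound on `|Kk x z|`: zero unless `x ∈ supp h ⊂ b` and `z ∈ b′`, and then the block distance is `|b − b′|`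
  have hterm : ∀ x z, |Kk x z| ≤ Hh * C₀ * E * (c * P x z) := by
    intro x z
    by_cases hx : h x = 0
    · rw [hKk]; simp only [hx, zero_mul, abs_zero]
      exact mul_nonneg (by positivity) (mul_nonneg hc0 (hP0 x z))
    by_cases hzb : blockOf N M z = b'
    · have hxb := hsh x hx
      have hkxz := hk x z
      rw [hxb, hzb] at hkxz
      rw [hKk]; simp only [hzb, if_true, mul_one]
      rw [abs_mul, abs_mul, abs_of_nonneg hc0]
      calc |h x| * (c * |k x z|) ≤ Hh * (c * (C₀ * P x z * E)) :=
            mul_le_mul (hh x) (mul_le_mul_of_nonneg_left hkxz hc0) (by positivity) hHh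
        _ = Hh * C₀ * E * (c * P x z) := by ring
    · rw [hKk]; simp only [hzb, if_false, mul_zero, abs_zero]
      exact mul_nonneg (by positivity) (mul_nonneg hc0 (hP0 x z))
  have hrow : ∀ x, ∑ z, |Kk x z| ≤ R := fun x =>
    calc ∑ z, |Kk x z| ≤ ∑ z, Hh * C₀ * E * (c * P x z) := Finset.sum_le_sum fun z _ => hterm x z
      _ = Hh * C₀ * E * ∑ z, c * P x z := by rw [Finset.mul_sum]
      _ ≤ Hh * C₀ * E * A := mul_le_mul_of_nonneg_left (hProw x) (by positivity)
      _ = R := by rw [hRdef]; ring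
  have hcol : ∀ z, ∑ x, |Kk x z| ≤ R := fun z =>
    calc ∑ x, |Kk x z| ≤ ∑ x, Hh * C₀ * E * (c * P x z) := Finset.sum_le_sum fun x _ => hterm x z
      _ = Hh * C₀ * E * ∑ x, c * P x z := by rw [Finset.mul_sum]
      _ ≤ Hh * C₀ * E * A := mul_le_mul_of_nonneg_left (hPcol z) (by positivity)
      _ = R := by rw [hRdef]; ring
  have h := schur_finsum_sq_le Kk lam hR0 hrow hcol
  calc _ ≤ R * R * ∑ z, lam z ^ 2 := h
    _ = (C₀ * A * Hh * E) ^ 2 * ∑ z, lam z ^ 2 := by rw [hRdef, sq]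

/-! ## §2 (3.46) at `U ≡ 1`: the entries `hGλ`, `h∇Gλ`, `hG∇*λ` -/

/-- ★★ **[B9] (3.46), ENTRY `hGλ`, AT `U ≡ 1`**: for odd `L ≥ 3`, `a > 0`, `m₀² ≥ 0` there are `C, δ > 0` such that for EVERY `K ≥ 1` (`N = L^K`), cube
`2L^e`, mass `0 < m² ≤ m₀²`, every cut-off `h` with `|h| ≤ H_h` supported in a unit block `b` and every source `λ` supported in a unit block `b′`:
`‖h·A₀⁻¹λ‖₂ ≤ C·H_h·e^{−δ|b − b′|}·‖λ‖₂` (squared: `Σ_x(h(x)(A₀⁻¹λ)(x))² ≤ (C H_h e^{−δ|b−b′|})²Σ_zλ(z)²`) — Schur's test on part R-d's profile with decay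
(`Λ = L^{d+1}∕L² ≤ L^d`).  The printed «`‖hG′λ‖ ≤ B₀(L^jη)²|h|e^{−δ₀d(y,y′)}‖λ‖`» at `U ≡ 1`, unit-scale sites.
[cite: Balaban1985BackgroundPropagators, Thm 3.1 (3.46) p.398 (first entry); King1986, (2.13) p.653, Thm 3.3 (3.7) p.656; Balaban1983RegularityDecay, Theorem (1.10) p.573] -/
theorem fullPropOp_l2_local (hLodd : Odd L) (hL : 2 ≤ L) {a : ℝ} (ha : 0 < a) {m0sq : ℝ} (hm0 : 0 ≤ m0sq) :
    ∃ C δ : ℝ, 0 < C ∧ 0 < δ ∧ ∀ (K : ℕ), 1 ≤ K → ∀ (N : ℕ) [NeZero N], N = L ^ K →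
      ∀ (e : ℕ) (M : Fin (d + 1) → ℕ) [∀ μ, NeZero (M μ)], (∀ μ, M μ = 2 * L ^ e) →
      ∀ (msq : ℝ), 0 < msq → msq ≤ m0sq → ∀ (lam h : Tor (fine N M) → ℝ) (Hh : ℝ) (b b' : Tor M), 0 ≤ Hh →
        (∀ x, |h x| ≤ Hh) → (∀ x, h x ≠ 0 → blockOf N M x = b) → (∀ z, lam z ≠ 0 → blockOf N M z = b') →
        ∑ x, (h x * ((fineOp N M (aK a L K) (((N : ℕ) : ℝ) ^ 2) msq)⁻¹ *ᵥ lam) x) ^ 2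
          ≤ (C * Hh * Real.exp (-(δ * tdistT M b b'))) ^ 2 * ∑ z, lam z ^ 2 := by
  have hLr : (1 : ℝ) ≤ L := by exact_mod_cast (show 1 ≤ L by omega)
  obtain ⟨C₀, δ₀, hC₀, hδ₀, HP⟩ := fullProp_profile_decay_unif (d := d) L hLodd hL ha hm0
  set δ₁ : ℝ := min δ₀ 1 with hδ₁
  have hδ₁0 : 0 < δ₁ := lt_min hδ₀ one_pos
  set A : ℝ := 2 * (4 * ((d : ℝ) + 1) / δ₁) ^ (d + 1) with hAdef
  have hA0 : 0 ≤ A := by positivity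
  refine ⟨C₀ * A + 1, δ₀, by positivity, hδ₀, ?_⟩
  intro K hK N _ hN e M _ hM msq hmsq hcap lam h Hh b b' hHh hh hsh hsl
  have hΛ : (L : ℝ) ^ (d + 1) / (L : ℝ) ^ 2 ≤ (L : ℝ) ^ d := by
    rw [div_le_iff₀ (by positivity), pow_succ]
    exact mul_le_mul_of_nonneg_left (le_self_pow₀ hLr (by norm_num)) (by positivity)
  -- the profile majorant at the rate `δ₁ ≤ δ₀`, symmetric in `(x, z)`
  set P : Tor (fine N M) → Tor (fine N M) → ℝ := fun x z => ∑ i ∈ Finset.range K, ((L : ℝ) ^ (d + 1) / (L : ℝ) ^ 2) ^ i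
      * Real.exp (-(δ₁ * (tdistT (fine N M) x z * (L : ℝ) ^ i / (N : ℝ)))) with hPdef
  have hP0 : ∀ x z, 0 ≤ P x z := fun x z => Finset.sum_nonneg fun i _ => by positivity
  have hPsymm : ∀ x z, P x z = P z x := fun x z => by simp only [hPdef, tdistT_symm (fine N M) x z]
  have hk : ∀ x z, |constrainedProp N M (aK a L K) (((N : ℕ) : ℝ) ^ 2) msq x z|
      ≤ C₀ * P x z * Real.exp (-(δ₀ * tdistT M (blockOf N M x) (blockOf N M z))) := by
    intro x z
    refine (HP K hK N hN e M hM msq hmsq hcap x z).trans (mul_le_mul_of_nonneg_right (mul_le_mul_of_nonneg_left ?_ hC₀.le) (Real.exp_pos _).le)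
    refine Finset.sum_le_sum fun i _ => mul_le_mul_of_nonneg_left (Real.exp_le_exp.mpr ?_) (by positivity)
    have h0 : 0 ≤ tdistT (fine N M) x z * (L : ℝ) ^ i / (N : ℝ) := by have := tdistT_nonneg (fine N M) x z; positivity
    nlinarith [mul_le_mul_of_nonneg_right (min_le_left δ₀ 1) h0]
  have hrow : ∀ x, ∑ z, ((N : ℝ) ^ (d + 1))⁻¹ * P x z ≤ A := fun x =>
    profile_fineSum_le L hL N hN M hδ₁0 (min_le_right _ _) (by positivity) hΛ x
  have hcol : ∀ z, ∑ x, ((N : ℝ) ^ (d + 1))⁻¹ * P x z ≤ A := fun z => by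
    rw [Finset.sum_congr rfl fun x _ => by rw [hPsymm x z]]
    exact profile_fineSum_le L hL N hN M hδ₁0 (min_le_right _ _) (by positivity) hΛ z
  have h := l2_local_of_kernel_bound N M (constrainedProp N M (aK a L K) (((N : ℕ) : ℝ) ^ 2) msq) P hC₀.le hA0 hP0 hk hrow hcol
    lam h b b' hHh hh hsh hsl
  have hrepr : ∀ x, ((fineOp N M (aK a L K) (((N : ℕ) : ℝ) ^ 2) msq)⁻¹ *ᵥ lam) x
      = ∑ z, ((N : ℝ) ^ (d + 1))⁻¹ * constrainedProp N M (aK a L K) (((N : ℕ) : ℝ) ^ 2) msq x z * lam z :=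
    fun x => inv_mulVec_eq_sum N M _ _ _ lam x
  rw [Finset.sum_congr rfl fun x _ => by rw [hrepr x]]
  refine h.trans (mul_le_mul_of_nonneg_right ?_ (Finset.sum_nonneg fun z _ => sq_nonneg _))
  have hE : 0 < Real.exp (-(δ₀ * tdistT M b b')) := Real.exp_pos _
  apply pow_le_pow_left₀ (by positivity)
  nlinarith [mul_nonneg hHh hE.le]

/-- ★★ **[B9] (3.46), ENTRY `h∇Gλ`, AT `U ≡ 1`**: with the same quantifiers, for every direction `μ`:
`Σ_x(h(x)·N((A₀⁻¹λ)(x + e_μ) − (A₀⁻¹λ)(x)))² ≤ (C H_h e^{−δ|b−b′|})²Σ_zλ(z)²` — Schur's test on part R-e's gradient profile with decay (`Λ = L^d`), through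
Q4a `inv_deriv_mulVec_eq_sum`.  The printed «`‖h∇_UG′λ‖ ≤ B₀L^jη|h|e^{−δ₀d(y,y′)}‖λ‖`» at `U ≡ 1`.
[cite: Balaban1985BackgroundPropagators, Thm 3.1 (3.46) p.398 (second entry); King1986, Prop. 3.7 (3.63) p.663, Thm 3.3 (3.7) p.656; Balaban1983RegularityDecay, Theorem (1.10) p.573] -/
theorem fullPropDOp_l2_local (hLodd : Odd L) (hL : 2 ≤ L) {a : ℝ} (ha : 0 < a) {m0sq : ℝ} (hm0 : 0 ≤ m0sq) :
    ∃ C δ : ℝ, 0 < C ∧ 0 < δ ∧ ∀ (K : ℕ), 1 ≤ K → ∀ (N : ℕ) [NeZero N], N = L ^ K →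
      ∀ (e : ℕ) (M : Fin (d + 1) → ℕ) [∀ μ, NeZero (M μ)], (∀ μ, M μ = 2 * L ^ e) →
      ∀ (msq : ℝ), 0 < msq → msq ≤ m0sq → ∀ (μ : Fin (d + 1)) (lam h : Tor (fine N M) → ℝ) (Hh : ℝ) (b b' : Tor M), 0 ≤ Hh →
        (∀ x, |h x| ≤ Hh) → (∀ x, h x ≠ 0 → blockOf N M x = b) → (∀ z, lam z ≠ 0 → blockOf N M z = b') →
        ∑ x, (h x * ((N : ℝ) * (((fineOp N M (aK a L K) (((N : ℕ) : ℝ) ^ 2) msq)⁻¹ *ᵥ lam) (x + unitVec (fine N M) μ)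
            - ((fineOp N M (aK a L K) (((N : ℕ) : ℝ) ^ 2) msq)⁻¹ *ᵥ lam) x))) ^ 2
          ≤ (C * Hh * Real.exp (-(δ * tdistT M b b'))) ^ 2 * ∑ z, lam z ^ 2 := by
  have hLr : (1 : ℝ) ≤ L := by exact_mod_cast (show 1 ≤ L by omega)
  obtain ⟨C₀, δ₀, hC₀, hδ₀, HP⟩ := fullPropD_profile_decay_unif (d := d) L hLodd hL ha hm0
  set δ₁ : ℝ := min δ₀ 1 with hδ₁
  have hδ₁0 : 0 < δ₁ := lt_min hδ₀ one_pos
  set A : ℝ := 2 * (4 * ((d : ℝ) + 1) / δ₁) ^ (d + 1) with hAdef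
  have hA0 : 0 ≤ A := by positivity
  refine ⟨C₀ * A + 1, δ₀, by positivity, hδ₀, ?_⟩
  intro K hK N _ hN e M _ hM msq hmsq hcap μ lam h Hh b b' hHh hh hsh hsl
  have hΛ : (L : ℝ) ^ (d + 1) / (L : ℝ) ^ 2 * L ≤ (L : ℝ) ^ d := (LamL_eq_pow L hL).le
  set P : Tor (fine N M) → Tor (fine N M) → ℝ := fun x z => ∑ i ∈ Finset.range K, ((L : ℝ) ^ (d + 1) / (L : ℝ) ^ 2 * L) ^ i
      * Real.exp (-(δ₁ * (tdistT (fine N M) x z * (L : ℝ) ^ i / (N : ℝ)))) with hPdef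
  have hP0 : ∀ x z, 0 ≤ P x z := fun x z => Finset.sum_nonneg fun i _ => by positivity
  have hPsymm : ∀ x z, P x z = P z x := fun x z => by simp only [hPdef, tdistT_symm (fine N M) x z]
  have hk : ∀ x z, |(N : ℝ) * (constrainedProp N M (aK a L K) (((N : ℕ) : ℝ) ^ 2) msq (x + unitVec (fine N M) μ) z
        - constrainedProp N M (aK a L K) (((N : ℕ) : ℝ) ^ 2) msq x z)|
      ≤ C₀ * P x z * Real.exp (-(δ₀ * tdistT M (blockOf N M x) (blockOf N M z))) := by
    intro x z
    refine (HP K hK N hN e M hM msq hmsq hcap μ x z).trans (mul_le_mul_of_nonneg_right (mul_le_mul_of_nonneg_left ?_ hC₀.le) (Real.exp_pos _).le)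
    refine Finset.sum_le_sum fun i _ => mul_le_mul_of_nonneg_left (Real.exp_le_exp.mpr ?_) (by positivity)
    have h0 : 0 ≤ tdistT (fine N M) x z * (L : ℝ) ^ i / (N : ℝ) := by have := tdistT_nonneg (fine N M) x z; positivity
    nlinarith [mul_le_mul_of_nonneg_right (min_le_left δ₀ 1) h0]
  have hrow : ∀ x, ∑ z, ((N : ℝ) ^ (d + 1))⁻¹ * P x z ≤ A := fun x =>
    profile_fineSum_le L hL N hN M hδ₁0 (min_le_right _ _) (by positivity) hΛ x
  have hcol : ∀ z, ∑ x, ((N : ℝ) ^ (d + 1))⁻¹ * P x z ≤ A := fun z => by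
    rw [Finset.sum_congr rfl fun x _ => by rw [hPsymm x z]]
    exact profile_fineSum_le L hL N hN M hδ₁0 (min_le_right _ _) (by positivity) hΛ z
  have h := l2_local_of_kernel_bound N M (fun x z => (N : ℝ) * (constrainedProp N M (aK a L K) (((N : ℕ) : ℝ) ^ 2) msq
      (x + unitVec (fine N M) μ) z - constrainedProp N M (aK a L K) (((N : ℕ) : ℝ) ^ 2) msq x z)) P hC₀.le hA0 hP0 hk hrow hcol
    lam h b b' hHh hh hsh hsl
  rw [Finset.sum_congr rfl fun x _ => by rw [inv_deriv_mulVec_eq_sum N M _ _ _ lam x μ]]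
  refine h.trans (mul_le_mul_of_nonneg_right ?_ (Finset.sum_nonneg fun z _ => sq_nonneg _))
  have hE : 0 < Real.exp (-(δ₀ * tdistT M b b')) := Real.exp_pos _
  apply pow_le_pow_left₀ (by positivity)
  nlinarith [mul_nonneg hHh hE.le]

/-- ★★ **[B9] (3.46), ENTRY `hG∇*λ`, AT `U ≡ 1`**: with the same quantifiers, for every direction `ν` (`(∇*_νλ)(y) = N(λ(y − e_ν) − λ(y))`):
`Σ_x(h(x)·(A₀⁻¹∇*_νλ)(x))² ≤ (C H_h e^{−δ|b−b′|})²Σ_zλ(z)²` — the transposed-gradient kernel (Q4a `inv_mulVec_adjDeriv_eq_sum`) has part R-e's profile at the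
transposed pair, so the same Schur bound applies.  The printed «`‖hG′∇*_Uλ‖ ≤ B₀L^jη|h|e^{−δ₀d(y,y′)}‖λ‖`» at `U ≡ 1`.
[cite: Balaban1985BackgroundPropagators, Thm 3.1 (3.46) p.398 (third entry); King1986, (2.13) p.653, Prop. 3.7 (3.63) p.663; Balaban1983RegularityDecay, Theorem (1.10) p.573] -/
theorem fullPropAdjOp_l2_local (hLodd : Odd L) (hL : 2 ≤ L) {a : ℝ} (ha : 0 < a) {m0sq : ℝ} (hm0 : 0 ≤ m0sq) :
    ∃ C δ : ℝ, 0 < C ∧ 0 < δ ∧ ∀ (K : ℕ), 1 ≤ K → ∀ (N : ℕ) [NeZero N], N = L ^ K →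
      ∀ (e : ℕ) (M : Fin (d + 1) → ℕ) [∀ μ, NeZero (M μ)], (∀ μ, M μ = 2 * L ^ e) →
      ∀ (msq : ℝ), 0 < msq → msq ≤ m0sq → ∀ (ν : Fin (d + 1)) (lam h : Tor (fine N M) → ℝ) (Hh : ℝ) (b b' : Tor M), 0 ≤ Hh →
        (∀ x, |h x| ≤ Hh) → (∀ x, h x ≠ 0 → blockOf N M x = b) → (∀ z, lam z ≠ 0 → blockOf N M z = b') →
        ∑ x, (h x * ((fineOp N M (aK a L K) (((N : ℕ) : ℝ) ^ 2) msq)⁻¹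
            *ᵥ (fun y => (N : ℝ) * (lam (y - unitVec (fine N M) ν) - lam y))) x) ^ 2
          ≤ (C * Hh * Real.exp (-(δ * tdistT M b b'))) ^ 2 * ∑ z, lam z ^ 2 := by
  have hLr : (1 : ℝ) ≤ L := by exact_mod_cast (show 1 ≤ L by omega)
  obtain ⟨C₀, δ₀, hC₀, hδ₀, HP⟩ := fullPropD_profile_decay_unif (d := d) L hLodd hL ha hm0
  set δ₁ : ℝ := min δ₀ 1 with hδ₁
  have hδ₁0 : 0 < δ₁ := lt_min hδ₀ one_pos
  set A : ℝ := 2 * (4 * ((d : ℝ) + 1) / δ₁) ^ (d + 1) with hAdef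
  have hA0 : 0 ≤ A := by positivity
  refine ⟨C₀ * A + 1, δ₀, by positivity, hδ₀, ?_⟩
  intro K hK N _ hN e M _ hM msq hmsq hcap ν lam h Hh b b' hHh hh hsh hsl
  have hΛ : (L : ℝ) ^ (d + 1) / (L : ℝ) ^ 2 * L ≤ (L : ℝ) ^ d := (LamL_eq_pow L hL).le
  set P : Tor (fine N M) → Tor (fine N M) → ℝ := fun x z => ∑ i ∈ Finset.range K, ((L : ℝ) ^ (d + 1) / (L : ℝ) ^ 2 * L) ^ i
      * Real.exp (-(δ₁ * (tdistT (fine N M) x z * (L : ℝ) ^ i / (N : ℝ)))) with hPdef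
  have hP0 : ∀ x z, 0 ≤ P x z := fun x z => Finset.sum_nonneg fun i _ => by positivity
  have hPsymm : ∀ x z, P x z = P z x := fun x z => by simp only [hPdef, tdistT_symm (fine N M) x z]
  -- the transposed-gradient kernel `N[G(z + e_ν, x) − G(z, x)]`: part R-e's profile at the pair `(z, x)`
  have hk : ∀ x z, |(N : ℝ) * (constrainedProp N M (aK a L K) (((N : ℕ) : ℝ) ^ 2) msq (z + unitVec (fine N M) ν) x
        - constrainedProp N M (aK a L K) (((N : ℕ) : ℝ) ^ 2) msq z x)|
      ≤ C₀ * P x z * Real.exp (-(δ₀ * tdistT M (blockOf N M x) (blockOf N M z))) := by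
    intro x z
    rw [hPsymm x z, tdistT_symm M (blockOf N M x)]
    refine (HP K hK N hN e M hM msq hmsq hcap ν z x).trans (mul_le_mul_of_nonneg_right (mul_le_mul_of_nonneg_left ?_ hC₀.le) (Real.exp_pos _).le)
    refine Finset.sum_le_sum fun i _ => mul_le_mul_of_nonneg_left (Real.exp_le_exp.mpr ?_) (by positivity)
    have h0 : 0 ≤ tdistT (fine N M) z x * (L : ℝ) ^ i / (N : ℝ) := by have := tdistT_nonneg (fine N M) z x; positivity
    nlinarith [mul_le_mul_of_nonneg_right (min_le_left δ₀ 1) h0]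
  have hrow : ∀ x, ∑ z, ((N : ℝ) ^ (d + 1))⁻¹ * P x z ≤ A := fun x =>
    profile_fineSum_le L hL N hN M hδ₁0 (min_le_right _ _) (by positivity) hΛ x
  have hcol : ∀ z, ∑ x, ((N : ℝ) ^ (d + 1))⁻¹ * P x z ≤ A := fun z => by
    rw [Finset.sum_congr rfl fun x _ => by rw [hPsymm x z]]
    exact profile_fineSum_le L hL N hN M hδ₁0 (min_le_right _ _) (by positivity) hΛ z
  have h := l2_local_of_kernel_bound N M (fun x z => (N : ℝ) * (constrainedProp N M (aK a L K) (((N : ℕ) : ℝ) ^ 2) msq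
      (z + unitVec (fine N M) ν) x - constrainedProp N M (aK a L K) (((N : ℕ) : ℝ) ^ 2) msq z x)) P hC₀.le hA0 hP0 hk hrow hcol
    lam h b b' hHh hh hsh hsl
  rw [Finset.sum_congr rfl fun x _ => by rw [inv_mulVec_adjDeriv_eq_sum N M _ _ _ lam x ν]]
  refine h.trans (mul_le_mul_of_nonneg_right ?_ (Finset.sum_nonneg fun z _ => sq_nonneg _))
  have hE : 0 < Real.exp (-(δ₀ * tdistT M b b')) := Real.exp_pos _
  apply pow_le_pow_left₀ (by positivity)
  nlinarith [mul_nonneg hHh hE.le]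

end Summit.QuantumFields.YangMills.BalabanUVNodes.N15KingModelRung.Curved
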